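import Summits.QuantumFields.BalabanUV.Beta.GAN24.CombFreeGaugeLegCharges
import Summits.QuantumFields.BalabanUV.Beta.GAN24.GaugeReadChargeComb
import Summits.QuantumFields.BalabanUV.Beta.GAN24.WilsonLetterFlatCharges
import Summits.QuantumFields.BalabanUV.Beta.SecondOrderSplitDecay

/-!
# `BalabanUV.Beta.GAN24.GaugeReadSourcePairing` — binder row G-an2-4 ∕ (CONV-C), the (S) row of RULING R-gan24p1-g27-1 B (viii), the Ward-type half (W-γ), EXIT class, jb = 0:
# **THE (γ)-TYPE SOURCE PAIRING AT THE LITERAL LEVEL-0 TABLES IN CLOSED FORM — `Σ'_x Σ_κ₂ dzψ·(Σ'_u Σ_κ n·𝒟(e)) = −(cE∕2)·⟨ψ⁺⊙colH G₀(e), d*d n⟩ + (cE∕4 − cΛ·wM1_0·(2Lc^{d+1})⁻¹)·⟨𝒬_{Lc}(σ_ψ⊙n), colM G₀(e)⟩`**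
# for every bounded COMB-FREE `n` with vanishing block contour sums and every bounded `ψ` (G-an2-4 formalisation swarm → CRUX TEAM (2), seat `b2b-balaban-gan24-formalise-leaf-06` = the (γ) hand,
# gen 47, INTENT 1 FILE B; ENGINE E-leaf06-g46-1 (M1)∕(M3) structurally)

NOT IN PRINT; OUR BOOKKEEPING ([folklore] BY NAME over FILE A `CombFreeGaugeLegCharges` (per-table charges, column Ward pairing, vertex charges), an2's `SecondOrderResponse.dM ∕ vertexFamily_dM`,
`SpineRooted.locStencil_SpureRecAt ∕ vertexFamily_M1At`, `AxialDressingRooted.decays_coDressKBmAt_KInvStep`, leaf-02's `WilsonLetterFlatCharges.spureRecAt_zero_inl_inl` (the border table is off the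
ff block), gen-8 `KernelLegCharges.summable_prod_of_biLoc`, `SecondOrderSplitDecay.summable_colH_mul_bdd ∕ summable_colM_mul_bdd`; 0 `def`, 0 cited fact, 0 `def … : Prop`, 0 sorry).
HONEST FRAMING (cell contract, verbatim): «discharging `BetaPertH` makes Bałaban's UV stability UNCONDITIONAL — a real constructive-QFT result; it is NOT the continuum limit and NOT the
Clay problem.»  HONEST DEPENDENCY (verbatim): «continuum YM on T⁴ ⇐ BetaPertH ∧ nine spine estimates (0/9 proved); BetaPertH ⇐ (D1) ∧ (D4) ∧ CAP+tail; G-an2-4 gates asym, D1 and NE2/3/4.»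

SETTING.  In-block root `ρ = toSite r`; `G₀ := coDressKBmAt ρ Lc (KInvStep Lc 0)`; `S₀ := SpureRecAt … 0 = cE•W + cVH•(border)`, `M₀ := M1At … 0 = (cΛ·wM1 0)•h^ρ`; slot `e = (ν, y′)`;
`𝒟(e) := dM G₀ Lc S₀ M₀ ν y′ = vertexOfK G₀ Lc S₀ ν y′ + vertexOfM G₀ Lc M₀ ν y′` — the source whose `G₀`-dressing is the literal (γ) response kernel of `GaugeReadChargeComb`.
* §1 **`tsum_prod_gaugeLeg_vertexOfK`** — FIELD-COLUMN SECTOR (`n` bounded comb-free, `ψ` bounded):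
  `Σ'_{(u,x)} Σ_{κκ₂} n κ u·dzψ κ₂ x·vertexOfK G₀ Lc S₀ ν y′ u x (inl κ)(inl κ₂) = −(cE∕2)·Σ'_t Σ_l ψ(t+e_l)·colH G₀ Lc ν y′ l t·(d*d n)_l(t) + (cE∕4)·Σ'_w Σ_κ 𝒬_{Lc}(σ_ψ⊙n) κ w·colM G₀ Lc ν y′ κ w`
  (FILE A §6 per channel, §4 per slot, §2 for the comb-free form `σ_ψ⊙n`).
* §2 **`tsum_prod_gaugeLeg_vertexOfM`** — MULTIPLIER-COLUMN SECTOR (`+ 𝒬_{Lc} n = 0`): `= −(cΛ·wM1 0)·(2Lc^{d+1})⁻¹·Σ'_w Σ_μ 𝒬_{Lc}(σ_ψ⊙n) μ w·colM G₀ Lc ν y′ μ w` (FILE A §6, §5).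
* §3 **`gaugeLeg_sourcePairing_dM`** — THE SUM, in the iterated form the exit pairing delivers (`x` outside): `Σ'_x Σ_κ₂ dzψ κ₂ x·(Σ'_u Σ_κ n κ u·𝒟(e) u x (inl κ)(inl κ₂)) =
  −(cE∕2)·Σ'_t Σ_l ψ(t+e_l)·colH G₀(e) l t·(d*d n)_l(t) + (cE∕4 − cΛ·wM1 0·(2Lc^{d+1})⁻¹)·Σ'_w Σ_κ 𝒬_{Lc}(σ_ψ⊙n) κ w·colM G₀(e) κ w`.
READING.  The first term is the `ψ⁺`-weighted ℋ-column read of the Maxwell image (ENGINE (M1)'s `R(e)` at `ψ = 1_{B(y)}`, `n = n_{m̃}`); the second is the DEFECT — the block contour sums of the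
bond-sum-weighted form `σ_ψ⊙n` against the multiplier column, carrying the Wilson share `cE∕4` and the whole constraint-Hessian sector; ENGINE (M3)'s «sE + s2 = R, sM = 0» says it vanishes
for the edge potential and block-constant `ψ` (a finite lattice identity, typed separately).  Asserts NO value of any resolvent column; NOTHING of (W-γ) ∕ (INV) ∕ (S) ∕ (Q-R) ∕ «T2Shape» ∕
(hW, hWall) discharged; NEVER «G-an2-4 closed» as (CONV-C); NOT D1, NOT `BetaPertH`, NOT continuum, NOT Clay.  2026-08-22; no existing file touched.
-/

noncomputable section

open Finset
open scoped BigOperators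
open Literature.MathematicalPhysics.QuantumFieldTheory
open Literature.MathematicalPhysics.QuantumFieldTheory.Balaban1983to89
open Literature.MathematicalPhysics.QuantumFieldTheory.Balaban1983to89.Beta
open B12Sec2to5 (l1 l1_nonneg)
open ExpKernelCalculus (Site MKer Decays BiLoc VertexFamily Zl comp summable_exp_shift')
open AffineAveraging (Form0 Form1 Form2 box toSite unitVec unitVec_apply dz curv curvAdj contourSum)
open AveragingContours (blk)
open AveragingHessianKernelsRooted (hessFFAt)
open RootedComb (axProjAt)
open OneStepResolventKernel (Fib wsum LocStencil)
open AveragingHessianKernels (ell)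
open OneStepKernelFamily (KInvStep colH vertexOfK abs_colH_le)
open SecondOrderResponse (colM vertexOfM dM dM_apply abs_colM_le vertexFamily_dM)
open InterLevelTransport (cwsum cwsum_apply)
open StepJetData (wilsonA)
open BalabanStepW2 (wM1)
open Summit.QuantumFields.BalabanUV.Beta.TameKernelCalculus
open Summit.QuantumFields.BalabanUV.Beta.AxialDressingRooted (IsCombBondAt coDressKBmAt decays_coDressKBmAt_KInvStep one_le_of_neZero)
open Summit.QuantumFields.BalabanUV.Beta.SpineRooted (SpureRecAt M1At locStencil_SpureRecAt vertexFamily_M1At)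
open Summit.QuantumFields.BalabanUV.Beta.GAN24.KernelLegCharges (hasSum_prod_wsum summable_prod_of_biLoc)
open Summit.QuantumFields.BalabanUV.Beta.GAN24.GaugeReadCharge (hasSum_prod_wsum_fine)
open Summit.QuantumFields.BalabanUV.Beta.GAN24.GaugeReadChargeDipole (abs_tsum_prod_le_of_biLoc)
open Summit.QuantumFields.BalabanUV.Beta.GAN24.GaugeReadChargeProfile (biLoc_weightMul locStencil_weightMul vertexFamily_weightMul wsum_weightMul_apply
  cwsum_weightMul_apply)
open Summit.QuantumFields.BalabanUV.Beta.GAN24.WilsonLetterFlatCharges (spureRecAt_zero_inl_inl)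
open Summit.QuantumFields.BalabanUV.Beta.SecondOrderSplitDecay (summable_colH_mul_bdd summable_colM_mul_bdd)
open BalabanStepJets (locStencil_mono)
open KKTFluctuationEnergy (abs_curv_le)
open ResolventComposition (abs_curvAdj_le)
open Summit.QuantumFields.BalabanUV.Beta.GAN24.CombFreeGaugeLegCharges (hasSum_prod_wilsonA_gaugeLeg hasSum_prod_hessFFAt_gaugeLeg tsum_curvAdj_curv_mul_colH_eq
  hasSum_prod_weight_vertexOfK hasSum_prod_weight_vertexOfM abs_curvAdj_curv_le abs_bondSum_mul_le)
open KKTFluctuationEnergy (abs_dz_le)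

namespace Summit.QuantumFields.BalabanUV.Beta.GAN24.GaugeReadSourcePairing

variable {d : ℕ}

/-! ## §1 The (γ)-type source pairing at the literal level-0 tables, field-column sector -/

/-- NOT IN PRINT; OUR BOOKKEEPING.  **THE FIELD-COLUMN SECTOR OF THE SOURCE PAIRING, IN CLOSED FORM** (`G₀ = coDressKBmAt (toSite r) Lc (KInvStep Lc 0)`, in-block root;
`S₀ = SpureRecAt … 0`; `n` bounded and COMB-FREE; `ψ` bounded; slot `(ν, y′)`):
`Σ'_{(u,x)} Σ_κ Σ_κ₂ n κ u·(dz ψ) κ₂ x·(vertexOfK G₀ Lc S₀ ν y′) u x (inl κ)(inl κ₂)`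
`= −(cE∕2)·Σ'_t Σ_l ψ(t + e_l)·colH G₀ Lc ν y′ l t·(d*d n)_l(t) + (cE∕4)·Σ'_w Σ_κ 𝒬_{Lc}(σ_ψ ⊙ n) κ w·colM G₀ Lc ν y′ κ w`, `σ_ψ(κ,u) = ψ u + ψ(u + e_κ)` —
§1 per channel, `CombFreeGaugeLegCharges.hasSum_prod_wilsonA_gaugeLeg` per slot (the border table has no ff block: `spureRecAt_zero_inl_inl`), and the ℋ-column Ward pairing
`CombFreeGaugeLegCharges.tsum_curvAdj_curv_mul_colH_eq` for the comb-free form `σ_ψ ⊙ n`. -/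
theorem tsum_prod_gaugeLeg_vertexOfK {Lc : ℕ} [NeZero Lc] {r : Fin (d + 1) → ℕ} (hr : r ∈ box (d + 1) Lc) (cE cVH cΛ : ℝ) (ν : Fin (d + 1)) (y' : Site (d + 1))
    {n : Form1 (d + 1) ℝ} {Bn : ℝ} (hnB : ∀ κ u, |n κ u| ≤ Bn) (hn0 : ∀ κ u, IsCombBondAt (toSite r) Lc κ u → n κ u = 0)
    {ψ : Site (d + 1) → ℝ} {Bψ : ℝ} (hψ : ∀ u, |ψ u| ≤ Bψ) :
    ∑' ux : Site (d + 1) × Site (d + 1), ∑ κ, ∑ κ₂, n κ ux.1 * dz ψ κ₂ ux.2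
        * vertexOfK (coDressKBmAt (toSite r) Lc (KInvStep (d := d) Lc 0)) Lc (SpureRecAt d Lc (toSite r) cE cVH cΛ 0) ν y' ux.1 ux.2 (Sum.inl κ) (Sum.inl κ₂)
      = -(cE / 2) * ∑' t, ∑ l, ψ (t + unitVec l) * colH (coDressKBmAt (toSite r) Lc (KInvStep (d := d) Lc 0)) Lc ν y' l t * curvAdj (curv n) l t
        + (cE / 4) * ∑' w, ∑ κ, contourSum Lc (fun κ u => (ψ u + ψ (u + unitVec κ)) * n κ u) κ w
            * colM (coDressKBmAt (toSite r) Lc (KInvStep (d := d) Lc 0)) Lc ν y' κ w := by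
  classical
  have hLc : 1 ≤ Lc := one_le_of_neZero Lc
  set G := coDressKBmAt (toSite r) Lc (KInvStep (d := d) Lc 0) with hGdef
  set S := SpureRecAt d Lc (toSite r) cE cVH cΛ 0 with hSdef
  obtain ⟨δG, CG, hδG, hCG, hG⟩ := decays_coDressKBmAt_KInvStep (d := d) hr 0
  obtain ⟨Cs, δs, hδs, hS⟩ := locStencil_SpureRecAt (d := d) (Lc := Lc) hLc hr cE cVH cΛ 0
  have hCs : 0 ≤ Cs := (hS 0 0).nonneg (Sum.inl 0)
  set δ : ℝ := min δs δG with hδdef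
  have hδ : 0 < δ := lt_min hδs hδG
  have hSδ : LocStencil S Cs δ := locStencil_mono hS hCs (min_le_left _ _)
  have hGK : ∃ δ C : ℝ, 0 < δ ∧ 0 ≤ C ∧ Decays G C δ := ⟨δG, CG, hδG, hCG, hG⟩
  -- the two-leg weights, one per channel
  have hBψ : 0 ≤ Bψ := (abs_nonneg _).trans (hψ 0)
  have hω : ∀ (κ κ₂ : Fin (d + 1)) (xz : Site (d + 1) × Site (d + 1)), |n κ xz.1 * dz ψ κ₂ xz.2| ≤ Bn * (2 * Bψ) := fun κ κ₂ xz => by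
    rw [abs_mul]; exact mul_le_mul (hnB κ xz.1) (abs_dz_le hψ κ₂ xz.2) (abs_nonneg _) ((abs_nonneg _).trans (hnB κ xz.1))
  -- §1 per channel
  have h1 : ∀ κ κ₂ : Fin (d + 1), HasSum (fun ux : Site (d + 1) × Site (d + 1) => (n κ ux.1 * dz ψ κ₂ ux.2) * vertexOfK G Lc S ν y' ux.1 ux.2 (Sum.inl κ) (Sum.inl κ₂))
      (∑ l, ∑' t, colH G Lc ν y' l t * ∑' ux : Site (d + 1) × Site (d + 1), (n κ ux.1 * dz ψ κ₂ ux.2) * S l t ux.1 ux.2 (Sum.inl κ) (Sum.inl κ₂)) :=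
    fun κ κ₂ => hasSum_prod_weight_vertexOfK hG hCG hSδ hδ (min_le_right _ _) (hω κ κ₂) ν y' (Sum.inl κ) (Sum.inl κ₂)
  have hsum := hasSum_sum fun κ (_ : κ ∈ (Finset.univ : Finset (Fin (d + 1)))) =>
    hasSum_sum fun κ₂ (_ : κ₂ ∈ (Finset.univ : Finset (Fin (d + 1)))) => h1 κ κ₂
  have eL : (fun ux : Site (d + 1) × Site (d + 1) => ∑ κ, ∑ κ₂, n κ ux.1 * dz ψ κ₂ ux.2 * vertexOfK G Lc S ν y' ux.1 ux.2 (Sum.inl κ) (Sum.inl κ₂))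
      = fun ux => ∑ κ ∈ Finset.univ, ∑ κ₂ ∈ Finset.univ, (n κ ux.1 * dz ψ κ₂ ux.2) * vertexOfK G Lc S ν y' ux.1 ux.2 (Sum.inl κ) (Sum.inl κ₂) := by
    funext ux; rfl
  rw [eL, hsum.tsum_eq]
  -- the slot charges: Wilson letter only (the border table is off the ff block)
  have hZ : ∀ l t, (∑ κ, ∑ κ₂, ∑' ux : Site (d + 1) × Site (d + 1), (n κ ux.1 * dz ψ κ₂ ux.2) * S l t ux.1 ux.2 (Sum.inl κ) (Sum.inl κ₂))
      = cE * (-(1 / 2 : ℝ) * ψ (t + unitVec l) * curvAdj (curv n) l t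
          + (1 / 4 : ℝ) * curvAdj (curv (fun κ u => (ψ u + ψ (u + unitVec κ)) * n κ u)) l t) := by
    intro l t
    have hs : ∀ κ κ₂, Summable fun ux : Site (d + 1) × Site (d + 1) => (n κ ux.1 * dz ψ κ₂ ux.2) * S l t ux.1 ux.2 (Sum.inl κ) (Sum.inl κ₂) :=
      fun κ κ₂ => summable_prod_of_biLoc (biLoc_weightMul (hSδ l t) (hω κ κ₂)) hδ (Sum.inl κ) (Sum.inl κ₂)
    have eκ : (∑ κ, ∑ κ₂, ∑' ux : Site (d + 1) × Site (d + 1), (n κ ux.1 * dz ψ κ₂ ux.2) * S l t ux.1 ux.2 (Sum.inl κ) (Sum.inl κ₂))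
        = ∑' ux : Site (d + 1) × Site (d + 1), ∑ κ, ∑ κ₂, (n κ ux.1 * dz ψ κ₂ ux.2) * S l t ux.1 ux.2 (Sum.inl κ) (Sum.inl κ₂) := by
      rw [Summable.tsum_finsetSum (fun κ _ => summable_sum fun κ₂ _ => hs κ κ₂)]
      exact Finset.sum_congr rfl fun κ _ => (Summable.tsum_finsetSum (fun κ₂ _ => hs κ κ₂)).symm
    rw [eκ]
    have e : ∀ ux : Site (d + 1) × Site (d + 1), (∑ κ, ∑ κ₂, (n κ ux.1 * dz ψ κ₂ ux.2) * S l t ux.1 ux.2 (Sum.inl κ) (Sum.inl κ₂))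
        = cE * ∑ κ, ∑ κ₂, n κ ux.1 * dz ψ κ₂ ux.2 * wilsonA d l t ux.1 ux.2 (Sum.inl κ) (Sum.inl κ₂) := by
      intro ux
      rw [Finset.mul_sum]
      refine Finset.sum_congr rfl fun κ _ => ?_
      rw [Finset.mul_sum]
      refine Finset.sum_congr rfl fun κ₂ _ => ?_
      rw [hSdef, spureRecAt_zero_inl_inl]; ring
    rw [tsum_congr e, tsum_mul_left, (hasSum_prod_wilsonA_gaugeLeg l t n ψ).tsum_eq]
  -- bounds for the summabilities in `t`
  have hZb : ∀ (κ κ₂ l : Fin (d + 1)) (t : Site (d + 1)),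
      |∑' ux : Site (d + 1) × Site (d + 1), (n κ ux.1 * dz ψ κ₂ ux.2) * S l t ux.1 ux.2 (Sum.inl κ) (Sum.inl κ₂)| ≤ Bn * (2 * Bψ) * Cs * (Zl (d + 1) δ * Zl (d + 1) δ) :=
    fun κ κ₂ l t => abs_tsum_prod_le_of_biLoc (biLoc_weightMul (hSδ l t) (hω κ κ₂)) hδ (Sum.inl κ) (Sum.inl κ₂)
  have hsZ : ∀ κ κ₂ l, Summable fun t => colH G Lc ν y' l t * ∑' ux : Site (d + 1) × Site (d + 1), (n κ ux.1 * dz ψ κ₂ ux.2) * S l t ux.1 ux.2 (Sum.inl κ) (Sum.inl κ₂) :=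
    fun κ κ₂ l => summable_colH_mul_bdd (N := Lc) hGK (hZb κ κ₂ l) ν y' l
  -- regroup: channels inside, slots outside
  have e2 : (∑ κ, ∑ κ₂, ∑ l, ∑' t, colH G Lc ν y' l t * ∑' ux : Site (d + 1) × Site (d + 1), (n κ ux.1 * dz ψ κ₂ ux.2) * S l t ux.1 ux.2 (Sum.inl κ) (Sum.inl κ₂))
      = ∑ l, ∑' t, colH G Lc ν y' l t * (cE * (-(1 / 2 : ℝ) * ψ (t + unitVec l) * curvAdj (curv n) l t
          + (1 / 4 : ℝ) * curvAdj (curv (fun κ u => (ψ u + ψ (u + unitVec κ)) * n κ u)) l t)) := by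
    have c1 : (∑ κ, ∑ κ₂, ∑ l, ∑' t, colH G Lc ν y' l t * ∑' ux : Site (d + 1) × Site (d + 1), (n κ ux.1 * dz ψ κ₂ ux.2) * S l t ux.1 ux.2 (Sum.inl κ) (Sum.inl κ₂))
        = ∑ l, ∑ κ, ∑ κ₂, ∑' t, colH G Lc ν y' l t * ∑' ux : Site (d + 1) × Site (d + 1), (n κ ux.1 * dz ψ κ₂ ux.2) * S l t ux.1 ux.2 (Sum.inl κ) (Sum.inl κ₂) := by
      calc (∑ κ, ∑ κ₂, ∑ l, ∑' t, colH G Lc ν y' l t * ∑' ux : Site (d + 1) × Site (d + 1), (n κ ux.1 * dz ψ κ₂ ux.2) * S l t ux.1 ux.2 (Sum.inl κ) (Sum.inl κ₂))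
          = ∑ κ, ∑ l, ∑ κ₂, ∑' t, colH G Lc ν y' l t * ∑' ux : Site (d + 1) × Site (d + 1), (n κ ux.1 * dz ψ κ₂ ux.2) * S l t ux.1 ux.2 (Sum.inl κ) (Sum.inl κ₂) :=
            Finset.sum_congr rfl fun κ _ => Finset.sum_comm
        _ = _ := Finset.sum_comm
    rw [c1]
    refine Finset.sum_congr rfl fun l _ => ?_
    have c2 : ∀ t, (∑ κ, ∑ κ₂, colH G Lc ν y' l t * ∑' ux : Site (d + 1) × Site (d + 1), (n κ ux.1 * dz ψ κ₂ ux.2) * S l t ux.1 ux.2 (Sum.inl κ) (Sum.inl κ₂))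
        = colH G Lc ν y' l t * (cE * (-(1 / 2 : ℝ) * ψ (t + unitVec l) * curvAdj (curv n) l t
          + (1 / 4 : ℝ) * curvAdj (curv (fun κ u => (ψ u + ψ (u + unitVec κ)) * n κ u)) l t)) := by
      intro t
      rw [← hZ l t, Finset.mul_sum]
      exact Finset.sum_congr rfl fun κ _ => by rw [Finset.mul_sum]
    rw [← tsum_congr c2, Summable.tsum_finsetSum (fun κ _ => summable_sum fun κ₂ _ => hsZ κ κ₂ l)]
    exact Finset.sum_congr rfl fun κ _ => (Summable.tsum_finsetSum (fun κ₂ _ => hsZ κ κ₂ l)).symm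
  rw [e2]
  -- split the two pieces
  have hψ' : ∀ l t, |ψ (t + unitVec l) * curvAdj (curv n) l t| ≤ Bψ * ((d + 1 : ℕ) * (2 * (4 * Bn)) + (d + 1 : ℕ) * (2 * (4 * Bn))) := fun l t => by
    rw [abs_mul]; exact mul_le_mul (hψ _) (abs_curvAdj_curv_le hnB l t) (abs_nonneg _) hBψ
  have hσB : ∀ κ u, |(fun κ u => (ψ u + ψ (u + unitVec κ)) * n κ u) κ u| ≤ 2 * Bψ * Bn := fun κ u => abs_bondSum_mul_le hψ hnB κ u
  have hsA : ∀ l, Summable fun t => colH G Lc ν y' l t * (ψ (t + unitVec l) * curvAdj (curv n) l t) := fun l => summable_colH_mul_bdd (N := Lc) hGK (hψ' l) ν y' l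
  have hsB : ∀ l, Summable fun t => colH G Lc ν y' l t * curvAdj (curv (fun κ u => (ψ u + ψ (u + unitVec κ)) * n κ u)) l t :=
    fun l => summable_colH_mul_bdd (N := Lc) hGK (fun t => abs_curvAdj_curv_le hσB l t) ν y' l
  have e3 : ∀ l, (∑' t, colH G Lc ν y' l t * (cE * (-(1 / 2 : ℝ) * ψ (t + unitVec l) * curvAdj (curv n) l t
          + (1 / 4 : ℝ) * curvAdj (curv (fun κ u => (ψ u + ψ (u + unitVec κ)) * n κ u)) l t)))
      = -(cE / 2) * ∑' t, colH G Lc ν y' l t * (ψ (t + unitVec l) * curvAdj (curv n) l t)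
        + (cE / 4) * ∑' t, colH G Lc ν y' l t * curvAdj (curv (fun κ u => (ψ u + ψ (u + unitVec κ)) * n κ u)) l t := by
    intro l
    rw [← tsum_mul_left, ← tsum_mul_left, ← ((hsA l).mul_left _).tsum_add ((hsB l).mul_left _)]
    exact tsum_congr fun t => by ring
  simp only [e3]
  rw [Finset.sum_add_distrib, ← Finset.mul_sum, ← Finset.mul_sum]
  congr 1
  · congr 1
    rw [← Summable.tsum_finsetSum (fun l _ => hsA l)]
    exact tsum_congr fun t => Finset.sum_congr rfl fun l _ => by ring
  · congr 1
    rw [← Summable.tsum_finsetSum (fun l _ => hsB l), ← tsum_curvAdj_curv_mul_colH_eq hr hσB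
      (fun κ u h => by show (ψ u + ψ (u + unitVec κ)) * n κ u = 0; rw [hn0 κ u h, mul_zero]) ν y']
    exact tsum_congr fun t => Finset.sum_congr rfl fun l _ => by ring

/-! ## §2 The multiplier-column sector -/

/-- NOT IN PRINT; OUR BOOKKEEPING.  **THE MULTIPLIER-COLUMN SECTOR OF THE SOURCE PAIRING, IN CLOSED FORM** (`M₀ = M1At … 0 = (cΛ·wM1 0)•h^ρ`; `n` bounded, comb-free, with VANISHING
block contour sums; `ψ` bounded): `Σ'_{(u,x)} Σ_κ Σ_κ₂ n κ u·(dz ψ) κ₂ x·(vertexOfM G₀ Lc M₀ ν y′) u x (inl κ)(inl κ₂) = −(cΛ·wM1 0)·(2Lc^{d+1})⁻¹·Σ'_w Σ_μ 𝒬_{Lc}(σ_ψ ⊙ n) μ w·colM G₀ Lc ν y′ μ w` —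
§1 per channel and `CombFreeGaugeLegCharges.hasSum_prod_hessFFAt_gaugeLeg` per slot. -/
theorem tsum_prod_gaugeLeg_vertexOfM {Lc : ℕ} [NeZero Lc] {r : Fin (d + 1) → ℕ} (hr : r ∈ box (d + 1) Lc) (cΛ : ℝ) (ν : Fin (d + 1)) (y' : Site (d + 1))
    {n : Form1 (d + 1) ℝ} {Bn : ℝ} (hnB : ∀ κ u, |n κ u| ≤ Bn) (hn0 : ∀ κ u, IsCombBondAt (toSite r) Lc κ u → n κ u = 0) (hq : ∀ κ y, contourSum Lc n κ y = 0)
    {ψ : Site (d + 1) → ℝ} {Bψ : ℝ} (hψ : ∀ u, |ψ u| ≤ Bψ) :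
    ∑' ux : Site (d + 1) × Site (d + 1), ∑ κ, ∑ κ₂, n κ ux.1 * dz ψ κ₂ ux.2
        * vertexOfM (coDressKBmAt (toSite r) Lc (KInvStep (d := d) Lc 0)) Lc (M1At d Lc (toSite r) cΛ 0) ν y' ux.1 ux.2 (Sum.inl κ) (Sum.inl κ₂)
      = -(cΛ * wM1 d Lc 0) * (2 * (Lc : ℝ) ^ (d + 1))⁻¹ * ∑' w, ∑ μ, contourSum Lc (fun κ u => (ψ u + ψ (u + unitVec κ)) * n κ u) μ w
            * colM (coDressKBmAt (toSite r) Lc (KInvStep (d := d) Lc 0)) Lc ν y' μ w := by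
  classical
  have hLc : 1 ≤ Lc := one_le_of_neZero Lc
  set G := coDressKBmAt (toSite r) Lc (KInvStep (d := d) Lc 0) with hGdef
  set M := M1At d Lc (toSite r) cΛ 0 with hMdef
  obtain ⟨δG, CG, hδG, hCG, hG⟩ := decays_coDressKBmAt_KInvStep (d := d) hr 0
  have hM := vertexFamily_M1At (d := d) (Lc := Lc) hLc hr cΛ 0 hδG.le
  set CM : ℝ := |cΛ * wM1 d Lc 0| * (2 * (ell (d + 1) Lc : ℝ) ^ 2 * Real.exp (4 * ((d : ℝ) + 1) * Lc * δG)) with hCMdef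
  have hGK : ∃ δ C : ℝ, 0 < δ ∧ 0 ≤ C ∧ Decays G C δ := ⟨δG, CG, hδG, hCG, hG⟩
  have hBψ : 0 ≤ Bψ := (abs_nonneg _).trans (hψ 0)
  have hω : ∀ (κ κ₂ : Fin (d + 1)) (xz : Site (d + 1) × Site (d + 1)), |n κ xz.1 * dz ψ κ₂ xz.2| ≤ Bn * (2 * Bψ) := fun κ κ₂ xz => by
    rw [abs_mul]; exact mul_le_mul (hnB κ xz.1) (abs_dz_le hψ κ₂ xz.2) (abs_nonneg _) ((abs_nonneg _).trans (hnB κ xz.1))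
  have h1 : ∀ κ κ₂ : Fin (d + 1), HasSum (fun ux : Site (d + 1) × Site (d + 1) => (n κ ux.1 * dz ψ κ₂ ux.2) * vertexOfM G Lc M ν y' ux.1 ux.2 (Sum.inl κ) (Sum.inl κ₂))
      (∑ μ, ∑' w, colM G Lc ν y' μ w * ∑' ux : Site (d + 1) × Site (d + 1), (n κ ux.1 * dz ψ κ₂ ux.2) * M μ w ux.1 ux.2 (Sum.inl κ) (Sum.inl κ₂)) :=
    fun κ κ₂ => hasSum_prod_weight_vertexOfM hLc hG hCG hM hδG le_rfl (hω κ κ₂) ν y' (Sum.inl κ) (Sum.inl κ₂)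
  have hsum := hasSum_sum fun κ (_ : κ ∈ (Finset.univ : Finset (Fin (d + 1)))) =>
    hasSum_sum fun κ₂ (_ : κ₂ ∈ (Finset.univ : Finset (Fin (d + 1)))) => h1 κ κ₂
  have eL : (fun ux : Site (d + 1) × Site (d + 1) => ∑ κ, ∑ κ₂, n κ ux.1 * dz ψ κ₂ ux.2 * vertexOfM G Lc M ν y' ux.1 ux.2 (Sum.inl κ) (Sum.inl κ₂))
      = fun ux => ∑ κ ∈ Finset.univ, ∑ κ₂ ∈ Finset.univ, (n κ ux.1 * dz ψ κ₂ ux.2) * vertexOfM G Lc M ν y' ux.1 ux.2 (Sum.inl κ) (Sum.inl κ₂) := by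
    funext ux; rfl
  rw [eL, hsum.tsum_eq]
  -- the slot charges of the rooted constraint-Hessian tables
  have hZ : ∀ μ w, (∑ κ, ∑ κ₂, ∑' ux : Site (d + 1) × Site (d + 1), (n κ ux.1 * dz ψ κ₂ ux.2) * M μ w ux.1 ux.2 (Sum.inl κ) (Sum.inl κ₂))
      = (cΛ * wM1 d Lc 0) * (-((2 * (Lc : ℝ) ^ (d + 1))⁻¹ * contourSum Lc (fun κ u => (ψ u + ψ (u + unitVec κ)) * n κ u) μ w)) := by
    intro μ w
    have hs : ∀ κ κ₂, Summable fun ux : Site (d + 1) × Site (d + 1) => (n κ ux.1 * dz ψ κ₂ ux.2) * M μ w ux.1 ux.2 (Sum.inl κ) (Sum.inl κ₂) :=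
      fun κ κ₂ => summable_prod_of_biLoc (biLoc_weightMul (hM μ w) (hω κ κ₂)) hδG (Sum.inl κ) (Sum.inl κ₂)
    have eκ : (∑ κ, ∑ κ₂, ∑' ux : Site (d + 1) × Site (d + 1), (n κ ux.1 * dz ψ κ₂ ux.2) * M μ w ux.1 ux.2 (Sum.inl κ) (Sum.inl κ₂))
        = ∑' ux : Site (d + 1) × Site (d + 1), ∑ κ, ∑ κ₂, (n κ ux.1 * dz ψ κ₂ ux.2) * M μ w ux.1 ux.2 (Sum.inl κ) (Sum.inl κ₂) := by
      rw [Summable.tsum_finsetSum (fun κ _ => summable_sum fun κ₂ _ => hs κ κ₂)]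
      exact Finset.sum_congr rfl fun κ _ => (Summable.tsum_finsetSum (fun κ₂ _ => hs κ κ₂)).symm
    rw [eκ]
    have e : ∀ ux : Site (d + 1) × Site (d + 1), (∑ κ, ∑ κ₂, (n κ ux.1 * dz ψ κ₂ ux.2) * M μ w ux.1 ux.2 (Sum.inl κ) (Sum.inl κ₂))
        = (cΛ * wM1 d Lc 0) * ∑ κ, ∑ κ₂, n κ ux.1 * dz ψ κ₂ ux.2 * hessFFAt (toSite r) Lc μ w ux.1 ux.2 (Sum.inl κ) (Sum.inl κ₂) := by
      intro ux
      rw [Finset.mul_sum]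
      refine Finset.sum_congr rfl fun κ _ => ?_
      rw [Finset.mul_sum]
      refine Finset.sum_congr rfl fun κ₂ _ => ?_
      rw [hMdef]
      simp only [M1At, Pi.smul_apply, smul_eq_mul]
      ring
    rw [tsum_congr e, tsum_mul_left, (hasSum_prod_hessFFAt_gaugeLeg hLc hr μ w hn0 hq ψ).tsum_eq]
  have hZb : ∀ (κ κ₂ μ : Fin (d + 1)) (w : Site (d + 1)),
      |∑' ux : Site (d + 1) × Site (d + 1), (n κ ux.1 * dz ψ κ₂ ux.2) * M μ w ux.1 ux.2 (Sum.inl κ) (Sum.inl κ₂)| ≤ Bn * (2 * Bψ) * CM * (Zl (d + 1) δG * Zl (d + 1) δG) :=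
    fun κ κ₂ μ w => abs_tsum_prod_le_of_biLoc (biLoc_weightMul (hM μ w) (hω κ κ₂)) hδG (Sum.inl κ) (Sum.inl κ₂)
  have hsZ : ∀ κ κ₂ μ, Summable fun w => colM G Lc ν y' μ w * ∑' ux : Site (d + 1) × Site (d + 1), (n κ ux.1 * dz ψ κ₂ ux.2) * M μ w ux.1 ux.2 (Sum.inl κ) (Sum.inl κ₂) :=
    fun κ κ₂ μ => summable_colM_mul_bdd (N := Lc) hGK (hZb κ κ₂ μ) ν y' μ
  have c1 : (∑ κ, ∑ κ₂, ∑ μ, ∑' w, colM G Lc ν y' μ w * ∑' ux : Site (d + 1) × Site (d + 1), (n κ ux.1 * dz ψ κ₂ ux.2) * M μ w ux.1 ux.2 (Sum.inl κ) (Sum.inl κ₂))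
      = ∑ μ, ∑ κ, ∑ κ₂, ∑' w, colM G Lc ν y' μ w * ∑' ux : Site (d + 1) × Site (d + 1), (n κ ux.1 * dz ψ κ₂ ux.2) * M μ w ux.1 ux.2 (Sum.inl κ) (Sum.inl κ₂) := by
    calc (∑ κ, ∑ κ₂, ∑ μ, ∑' w, colM G Lc ν y' μ w * ∑' ux : Site (d + 1) × Site (d + 1), (n κ ux.1 * dz ψ κ₂ ux.2) * M μ w ux.1 ux.2 (Sum.inl κ) (Sum.inl κ₂))
        = ∑ κ, ∑ μ, ∑ κ₂, ∑' w, colM G Lc ν y' μ w * ∑' ux : Site (d + 1) × Site (d + 1), (n κ ux.1 * dz ψ κ₂ ux.2) * M μ w ux.1 ux.2 (Sum.inl κ) (Sum.inl κ₂) :=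
          Finset.sum_congr rfl fun κ _ => Finset.sum_comm
      _ = _ := Finset.sum_comm
  rw [c1]
  have c2 : ∀ μ w, (∑ κ, ∑ κ₂, colM G Lc ν y' μ w * ∑' ux : Site (d + 1) × Site (d + 1), (n κ ux.1 * dz ψ κ₂ ux.2) * M μ w ux.1 ux.2 (Sum.inl κ) (Sum.inl κ₂))
      = colM G Lc ν y' μ w * ((cΛ * wM1 d Lc 0) * (-((2 * (Lc : ℝ) ^ (d + 1))⁻¹ * contourSum Lc (fun κ u => (ψ u + ψ (u + unitVec κ)) * n κ u) μ w))) := by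
    intro μ w
    rw [← hZ μ w, Finset.mul_sum]
    exact Finset.sum_congr rfl fun κ _ => by rw [Finset.mul_sum]
  have c3 : ∀ μ, (∑ κ, ∑ κ₂, ∑' w, colM G Lc ν y' μ w * ∑' ux : Site (d + 1) × Site (d + 1), (n κ ux.1 * dz ψ κ₂ ux.2) * M μ w ux.1 ux.2 (Sum.inl κ) (Sum.inl κ₂))
      = ∑' w, colM G Lc ν y' μ w * ((cΛ * wM1 d Lc 0) * (-((2 * (Lc : ℝ) ^ (d + 1))⁻¹ * contourSum Lc (fun κ u => (ψ u + ψ (u + unitVec κ)) * n κ u) μ w))) := by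
    intro μ
    rw [← tsum_congr (c2 μ), Summable.tsum_finsetSum (fun κ _ => summable_sum fun κ₂ _ => hsZ κ κ₂ μ)]
    exact Finset.sum_congr rfl fun κ _ => (Summable.tsum_finsetSum (fun κ₂ _ => hsZ κ κ₂ μ)).symm
  simp only [c3]
  -- collect the constant
  have hσB : ∀ κ u, |(fun κ u => (ψ u + ψ (u + unitVec κ)) * n κ u) κ u| ≤ 2 * Bψ * Bn := fun κ u => abs_bondSum_mul_le hψ hnB κ u
  have hQb : ∀ μ w, |contourSum Lc (fun κ u => (ψ u + ψ (u + unitVec κ)) * n κ u) μ w| ≤ ∑ b ∈ box (d + 1) Lc, ∑ s ∈ Finset.range Lc, 2 * Bψ * Bn := by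
    intro μ w
    simp only [AffineAveraging.contourSum]
    exact (Finset.abs_sum_le_sum_abs _ _).trans (Finset.sum_le_sum fun b _ => (Finset.abs_sum_le_sum_abs _ _).trans (Finset.sum_le_sum fun s _ => hσB μ _))
  have hsQ : ∀ μ, Summable fun w => colM G Lc ν y' μ w * contourSum Lc (fun κ u => (ψ u + ψ (u + unitVec κ)) * n κ u) μ w :=
    fun μ => summable_colM_mul_bdd (N := Lc) hGK (hQb μ) ν y' μ
  have c4 : ∀ μ, (∑' w, colM G Lc ν y' μ w * ((cΛ * wM1 d Lc 0) * (-((2 * (Lc : ℝ) ^ (d + 1))⁻¹ * contourSum Lc (fun κ u => (ψ u + ψ (u + unitVec κ)) * n κ u) μ w))))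
      = (-(cΛ * wM1 d Lc 0) * (2 * (Lc : ℝ) ^ (d + 1))⁻¹) * ∑' w, contourSum Lc (fun κ u => (ψ u + ψ (u + unitVec κ)) * n κ u) μ w * colM G Lc ν y' μ w := by
    intro μ
    rw [← tsum_mul_left]
    exact tsum_congr fun w => by ring
  simp only [c4]
  rw [← Finset.mul_sum, Summable.tsum_finsetSum (fun μ _ => (hsQ μ).congr fun w => mul_comm _ _)]

/-! ## §3 The source pairing of the full slot derivative `𝒟(e) = dM G₀ Lc S₀ M₀ ν y′` -/

/-- NOT IN PRINT; OUR BOOKKEEPING.  **THE (γ)-TYPE SOURCE PAIRING AT LEVEL 0, IN CLOSED FORM** (in-block root; `G₀`, `S₀ = SpureRecAt … 0`, `M₀ = M1At … 0`, slot `(ν, y′)`,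
`𝒟(e) := dM G₀ Lc S₀ M₀ ν y′`; `n` bounded, COMB-FREE, with VANISHING block contour sums; `ψ` bounded):
`Σ'_x Σ_κ₂ (dz ψ) κ₂ x·(Σ'_u Σ_κ n κ u·𝒟(e) u x (inl κ)(inl κ₂))`
`= −(cE∕2)·Σ'_t Σ_l ψ(t + e_l)·colH G₀ Lc ν y′ l t·(d*d n)_l(t) + (cE∕4 − cΛ·wM1 0·(2Lc^{d+1})⁻¹)·Σ'_w Σ_κ 𝒬_{Lc}(σ_ψ ⊙ n) κ w·colM G₀ Lc ν y′ κ w`.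
The first term is the `ψ⁺`-weighted ℋ-column read of the Maxwell image of `n`; the second is the DEFECT — the block contour sums of the bond-sum-weighted form `σ_ψ ⊙ n` read
against the multiplier column (it carries the Wilson share `cE∕4` and the whole constraint-Hessian sector). -/
theorem gaugeLeg_sourcePairing_dM {Lc : ℕ} [NeZero Lc] {r : Fin (d + 1) → ℕ} (hr : r ∈ box (d + 1) Lc) (cE cVH cΛ : ℝ) (ν : Fin (d + 1)) (y' : Site (d + 1))
    {n : Form1 (d + 1) ℝ} {Bn : ℝ} (hnB : ∀ κ u, |n κ u| ≤ Bn) (hn0 : ∀ κ u, IsCombBondAt (toSite r) Lc κ u → n κ u = 0) (hq : ∀ κ y, contourSum Lc n κ y = 0)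
    {ψ : Site (d + 1) → ℝ} {Bψ : ℝ} (hψ : ∀ u, |ψ u| ≤ Bψ) :
    ∑' x, ∑ κ₂, dz ψ κ₂ x * (∑' u, ∑ κ, n κ u
        * dM (coDressKBmAt (toSite r) Lc (KInvStep (d := d) Lc 0)) Lc (SpureRecAt d Lc (toSite r) cE cVH cΛ 0) (M1At d Lc (toSite r) cΛ 0) ν y' u x (Sum.inl κ) (Sum.inl κ₂))
      = -(cE / 2) * (∑' t, ∑ l, ψ (t + unitVec l) * colH (coDressKBmAt (toSite r) Lc (KInvStep (d := d) Lc 0)) Lc ν y' l t * curvAdj (curv n) l t)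
        + (cE / 4 - (cΛ * wM1 d Lc 0) * (2 * (Lc : ℝ) ^ (d + 1))⁻¹)
          * ∑' w, ∑ κ, contourSum Lc (fun κ u => (ψ u + ψ (u + unitVec κ)) * n κ u) κ w * colM (coDressKBmAt (toSite r) Lc (KInvStep (d := d) Lc 0)) Lc ν y' κ w := by
  classical
  have hLc : 1 ≤ Lc := one_le_of_neZero Lc
  set G := coDressKBmAt (toSite r) Lc (KInvStep (d := d) Lc 0) with hGdef
  set S := SpureRecAt d Lc (toSite r) cE cVH cΛ 0 with hSdef
  set M := M1At d Lc (toSite r) cΛ 0 with hMdef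
  obtain ⟨δG, CG, hδG, hCG, hG⟩ := decays_coDressKBmAt_KInvStep (d := d) hr 0
  obtain ⟨Cs, δs, hδs, hS⟩ := locStencil_SpureRecAt (d := d) (Lc := Lc) hLc hr cE cVH cΛ 0
  have hCs : 0 ≤ Cs := (hS 0 0).nonneg (Sum.inl 0)
  set δ : ℝ := min δs δG with hδdef
  have hδ : 0 < δ := lt_min hδs hδG
  have hSδ : LocStencil S Cs δ := locStencil_mono hS hCs (min_le_left _ _)
  have hMδ := vertexFamily_M1At (d := d) (Lc := Lc) hLc hr cΛ 0 hδ.le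
  have hW := vertexFamily_dM (N := Lc) hG hCG hSδ hMδ hδ (min_le_right _ _) ν y'
  have hδ2 : 0 < δ / 2 := by positivity
  have hBψ : 0 ≤ Bψ := (abs_nonneg _).trans (hψ 0)
  have hω : ∀ (κ κ₂ : Fin (d + 1)) (xz : Site (d + 1) × Site (d + 1)), |n κ xz.1 * dz ψ κ₂ xz.2| ≤ Bn * (2 * Bψ) := fun κ κ₂ xz => by
    rw [abs_mul]; exact mul_le_mul (hnB κ xz.1) (abs_dz_le hψ κ₂ xz.2) (abs_nonneg _) ((abs_nonneg _).trans (hnB κ xz.1))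
  -- product summability of the weighted derivative, per channel
  have hsF : ∀ κ κ₂, Summable fun ux : Site (d + 1) × Site (d + 1) => (n κ ux.1 * dz ψ κ₂ ux.2) * dM G Lc S M ν y' ux.1 ux.2 (Sum.inl κ) (Sum.inl κ₂) :=
    fun κ κ₂ => summable_prod_of_biLoc (biLoc_weightMul hW (hω κ κ₂)) hδ2 (Sum.inl κ) (Sum.inl κ₂)
  have hsF' : Summable fun ux : Site (d + 1) × Site (d + 1) => ∑ κ, ∑ κ₂, (n κ ux.1 * dz ψ κ₂ ux.2) * dM G Lc S M ν y' ux.1 ux.2 (Sum.inl κ) (Sum.inl κ₂) :=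
    summable_sum fun κ _ => summable_sum fun κ₂ _ => hsF κ κ₂
  -- columns of `𝒟(e)` are summable in the first leg
  obtain ⟨CW, hCW⟩ : ∃ CW : ℝ, BiLoc (dM G Lc S M ν y') ((Lc : ℤ) • y') ((Lc : ℤ) • y') CW (δ / 2) := ⟨_, hW⟩
  have hcol : ∀ x κ κ₂, Summable fun u => n κ u * dM G Lc S M ν y' u x (Sum.inl κ) (Sum.inl κ₂) := by
    intro x κ κ₂
    have hC0 : 0 ≤ CW := hCW.nonneg (Sum.inl κ)
    refine Summable.of_norm_bounded (((summable_exp_shift' hδ2 ((Lc : ℤ) • y')).mul_left (Bn * CW)).mul_right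
      (Real.exp (-(δ / 2) * l1 (x - (Lc : ℤ) • y')))) (fun u => ?_)
    rw [Real.norm_eq_abs, abs_mul]
    have h := hCW u x (Sum.inl κ) (Sum.inl κ₂)
    rw [mul_add, Real.exp_add] at h
    calc |n κ u| * |dM G Lc S M ν y' u x (Sum.inl κ) (Sum.inl κ₂)|
        ≤ Bn * (CW * (Real.exp (-(δ / 2) * l1 (u - (Lc : ℤ) • y')) * Real.exp (-(δ / 2) * l1 (x - (Lc : ℤ) • y')))) :=
          mul_le_mul (hnB κ u) h (abs_nonneg _) ((abs_nonneg _).trans (hnB κ u))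
      _ = Bn * CW * Real.exp (-(δ / 2) * l1 (u - (Lc : ℤ) • y')) * Real.exp (-(δ / 2) * l1 (x - (Lc : ℤ) • y')) := by ring
  -- iterated form = product form
  have e1 : ∀ x, (∑ κ₂, dz ψ κ₂ x * ∑' u, ∑ κ, n κ u * dM G Lc S M ν y' u x (Sum.inl κ) (Sum.inl κ₂))
      = ∑' u, ∑ κ, ∑ κ₂, (n κ u * dz ψ κ₂ x) * dM G Lc S M ν y' u x (Sum.inl κ) (Sum.inl κ₂) := by
    intro x
    have hs : ∀ κ₂, Summable fun u => ∑ κ, n κ u * dM G Lc S M ν y' u x (Sum.inl κ) (Sum.inl κ₂) := fun κ₂ => summable_sum fun κ _ => hcol x κ κ₂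
    have e : ∀ κ₂, dz ψ κ₂ x * ∑' u, ∑ κ, n κ u * dM G Lc S M ν y' u x (Sum.inl κ) (Sum.inl κ₂)
        = ∑' u, ∑ κ, (n κ u * dz ψ κ₂ x) * dM G Lc S M ν y' u x (Sum.inl κ) (Sum.inl κ₂) := fun κ₂ => by
      rw [← tsum_mul_left]
      refine tsum_congr fun u => ?_
      rw [Finset.mul_sum]
      exact Finset.sum_congr rfl fun κ _ => by ring
    simp only [e]
    rw [← Summable.tsum_finsetSum (fun κ₂ _ => ((hs κ₂).mul_left (dz ψ κ₂ x)).congr fun u => by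
      rw [Finset.mul_sum]; exact Finset.sum_congr rfl fun κ _ => by ring)]
    exact tsum_congr fun u => Finset.sum_comm
  rw [tsum_congr e1]
  have hsU : Summable (Function.uncurry fun u x => ∑ κ, ∑ κ₂, (n κ u * dz ψ κ₂ x) * dM G Lc S M ν y' u x (Sum.inl κ) (Sum.inl κ₂)) := hsF'
  have e2 : ∑' x, ∑' u, ∑ κ, ∑ κ₂, (n κ u * dz ψ κ₂ x) * dM G Lc S M ν y' u x (Sum.inl κ) (Sum.inl κ₂)
      = ∑' ux : Site (d + 1) × Site (d + 1), ∑ κ, ∑ κ₂, (n κ ux.1 * dz ψ κ₂ ux.2) * dM G Lc S M ν y' ux.1 ux.2 (Sum.inl κ) (Sum.inl κ₂) := by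
    rw [hsU.tsum_comm]
    exact (hsU.tsum_prod).symm
  rw [e2]
  -- split the derivative into its two chain-rule vertices
  have e3 : ∀ ux : Site (d + 1) × Site (d + 1), (∑ κ, ∑ κ₂, (n κ ux.1 * dz ψ κ₂ ux.2) * dM G Lc S M ν y' ux.1 ux.2 (Sum.inl κ) (Sum.inl κ₂))
      = (∑ κ, ∑ κ₂, n κ ux.1 * dz ψ κ₂ ux.2 * vertexOfK G Lc S ν y' ux.1 ux.2 (Sum.inl κ) (Sum.inl κ₂))
        + ∑ κ, ∑ κ₂, n κ ux.1 * dz ψ κ₂ ux.2 * vertexOfM G Lc M ν y' ux.1 ux.2 (Sum.inl κ) (Sum.inl κ₂) := by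
    intro ux
    rw [← Finset.sum_add_distrib]
    refine Finset.sum_congr rfl fun κ _ => ?_
    rw [← Finset.sum_add_distrib]
    refine Finset.sum_congr rfl fun κ₂ _ => ?_
    rw [dM_apply]; ring
  have hsK : Summable fun ux : Site (d + 1) × Site (d + 1) => ∑ κ, ∑ κ₂, n κ ux.1 * dz ψ κ₂ ux.2 * vertexOfK G Lc S ν y' ux.1 ux.2 (Sum.inl κ) (Sum.inl κ₂) :=
    summable_sum fun κ _ => summable_sum fun κ₂ _ =>
      (hasSum_prod_weight_vertexOfK hG hCG hSδ hδ (min_le_right _ _) (hω κ κ₂) ν y' (Sum.inl κ) (Sum.inl κ₂)).summable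
  have hsM : Summable fun ux : Site (d + 1) × Site (d + 1) => ∑ κ, ∑ κ₂, n κ ux.1 * dz ψ κ₂ ux.2 * vertexOfM G Lc M ν y' ux.1 ux.2 (Sum.inl κ) (Sum.inl κ₂) :=
    summable_sum fun κ _ => summable_sum fun κ₂ _ =>
      (hasSum_prod_weight_vertexOfM hLc hG hCG hMδ hδ (min_le_right _ _) (hω κ κ₂) ν y' (Sum.inl κ) (Sum.inl κ₂)).summable
  rw [tsum_congr e3, hsK.tsum_add hsM, hGdef, hSdef, hMdef, tsum_prod_gaugeLeg_vertexOfK hr cE cVH cΛ ν y' hnB hn0 hψ,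
    tsum_prod_gaugeLeg_vertexOfM hr cΛ ν y' hnB hn0 hq hψ]
  ring

end Summit.QuantumFields.BalabanUV.Beta.GAN24.GaugeReadSourcePairing

end
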